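import Mathlib
import Literature.NumberTheory.Transcendental.DrinfeldAssociatorTransport
import Literature.NumberTheory.Transcendental.AssociatorsEvalProofs
import HarnessLib

/-!
# Parametric iterated integrals, the variation identity, and nilpotent uniqueness

Fourth proofs file towards `drinfeldAssociator_pentagon` (`DrinfeldAssociator.lean`,
[Drinfeld1991, (2.13)]): the generic calculus behind "a FLAT connection has trivial holonomy around
a triangle" — the two-dimensional input of Drinfeld's argument (the KZ connection
`Σ t_ij dlog(z_i - z_j)` is flat by the infinitesimal braid relations, [Drinfeld1991, §2]) — in the
coefficientwise language of `DrinfeldAssociatorTransport.lean`. Everything is proved; no named fact.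

1. **Differentiation under nested integrals** (`§ Parametric`): for letter densities `g_c(s, σ)`
   depending on a parameter `s`, jointly continuous together with `g'_c = ∂_s g_c`, the parametric
   iterated integrals `F_w(s,σ) = I^{g(s,·)}_w(0,σ)` (`pF`) are jointly continuous and
   `∂_s F_w = D_w` (`hasDerivAt_pF`), `D_w` (`pD`) being the nested integral obtained by
   differentiating under the integral sign (dominated differentiation on compact neighbourhoods).
2. **The variation identity** (`§ SigmaDeriv`): with `Ĵ(σ) = Σ F_w(s,σ) w`, `D̂ = ∂_s Ĵ`,
   `ĝ(σ) = Σ_c g_c(s,σ) c`, a second letter family `b̂(σ) = Σ_c h_c(s,σ) c` with `∂_σ h = ∂_s g`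
   (equality of mixed partials of `log ℓ`), and `M̂ := D̂ - b̂ Ĵ + Ĵ b̂(0)`:
   `∂_σ M̂ = ĝ M̂ + [ĝ, b̂] Ĵ`, `M̂(0) = 0` (`hasDerivAt_pM`, `pM_zero`) — the classical computation
   showing that the variation of parallel transport is governed by the curvature.
3. **Kernels are closed under integration** (`sum_integral_smul_mem`,
   `evalTrunc_sub_mem_of_integral`): if `Σ_i D_i(s) • m_i` lies in a submodule `S` of a real vector
   space for all `s`, so does `Σ_i (∫ D_i) • m_i` (linear functionals on `V ⧸ S` separate points; no
   topology on `V`), applied to `ev = NCSeries.evalTrunc N v` which reads finitely many coefficients.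
4. **Nilpotent uniqueness** (`evalTrunc_eq_zero_of_hasDerivAt`): in an algebra with a finite
   filtration `⊤ = T₀ ⊇ T₁ ⊇ ⋯ ⊇ T_K = 0`, `v(c) T_j ⊆ T_{j+1}` (the truncated Drinfeld–Kohno
   algebras), a series family with `ev(∂_σ M̂) = ev(k̂ M̂)`, `k̂` a letter series, and `ev(M̂(0)) = 0`
   has `ev(M̂) ≡ 0` — replacing Grönwall's inequality, which is unavailable without a norm.

## References

* V. G. Drinfel'd, Leningrad Math. J. 2 (1991), 829–860, §2. [Drinfeld1991]
* K.-T. Chen, Bull. AMS 83 (1977), §2 (variation of iterated integrals). Standard: `[folklore]`.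
-/

noncomputable section

open MeasureTheory intervalIntegral Set Filter Metric
open scoped BigOperators Topology

namespace Literature.NumberTheory.Transcendental

universe u


section Parametric

variable {α : Type u}

/-- Parametric iterated integrals `F_w(s, σ) = I^{g(s,·)}_w(0, σ)` for letter densities depending on
a parameter `s`. [folklore] -/
def pF (g : α → ℝ → ℝ → ℝ) (w : List α) (s σ : ℝ) : ℝ := iterInt (fun c => g c s) w 0 σ

/-- The candidate `∂_s F_w(s,σ)`, by the recursion obtained from differentiating under the integral:
`D_∅ = 0`, `D_{cw}(s,σ) = ∫₀^σ (∂_s g_c · F_w + g_c · D_w)(s,τ) dτ`. [folklore] -/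
def pD (g g' : α → ℝ → ℝ → ℝ) : List α → ℝ → ℝ → ℝ
  | [], _, _ => 0
  | c :: w, s, σ => ∫ τ in (0 : ℝ)..σ, (g' c s τ * pF g w s τ + g c s τ * pD g g' w s τ)

variable {g g' : α → ℝ → ℝ → ℝ}

/-- `F_∅ = 1`. [folklore] -/
@[simp] theorem pF_nil (s σ : ℝ) : pF g [] s σ = 1 := rfl

/-- The recursion of `F`. [folklore] -/
theorem pF_cons (c : α) (w : List α) (s σ : ℝ) :
    pF g (c :: w) s σ = ∫ τ in (0 : ℝ)..σ, g c s τ * pF g w s τ := rfl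

/-- `D_∅ = 0`. [folklore] -/
@[simp] theorem pD_nil (s σ : ℝ) : pD g g' [] s σ = 0 := rfl

/-- The recursion of `D`. [folklore] -/
theorem pD_cons (c : α) (w : List α) (s σ : ℝ) :
    pD g g' (c :: w) s σ = ∫ τ in (0 : ℝ)..σ, (g' c s τ * pF g w s τ + g c s τ * pD g g' w s τ) := rfl

/-- `D_w(s, 0) = 0`. [folklore] -/
@[simp] theorem pD_zero (w : List α) (s : ℝ) : pD g g' w s 0 = 0 := by
  cases w <;> simp [pD]

variable (hg : ∀ c, Continuous fun p : ℝ × ℝ => g c p.1 p.2)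
  (hg' : ∀ c, Continuous fun p : ℝ × ℝ => g' c p.1 p.2)
include hg

/-- Joint continuity of `F_w` (parametric primitives of continuous functions). [folklore] -/
theorem continuous_pF : ∀ w : List α, Continuous fun p : ℝ × ℝ => pF g w p.1 p.2
  | [] => by simpa [pF] using continuous_const
  | c :: w => by
    have h : Continuous (Function.uncurry fun s τ => g c s τ * pF g w s τ) :=
      (hg c).mul (continuous_pF w)
    simpa [pF_cons] using intervalIntegral.continuous_parametric_primitive_of_continuous
      (a₀ := (0 : ℝ)) (μ := volume) h

include hg'

/-- Joint continuity of `D_w`. [folklore] -/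
theorem continuous_pD : ∀ w : List α, Continuous fun p : ℝ × ℝ => pD g g' w p.1 p.2
  | [] => by simpa [pD] using continuous_const
  | c :: w => by
    have h : Continuous (Function.uncurry fun s τ =>
        g' c s τ * pF g w s τ + g c s τ * pD g g' w s τ) :=
      ((hg' c).mul (continuous_pF hg w)).add ((hg c).mul (continuous_pD w))
    simpa [pD_cons] using intervalIntegral.continuous_parametric_primitive_of_continuous
      (a₀ := (0 : ℝ)) (μ := volume) h

/-- **Differentiation under the nested integrals**: on the open set `S` of parameters where every
`g_c(·, τ)` has derivative `g'_c(·, τ)`, `∂_s F_w(s,σ) = D_w(s,σ)`. [folklore] -/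
theorem hasDerivAt_pF {S : Set ℝ} (hS : IsOpen S)
    (hder : ∀ c, ∀ s ∈ S, ∀ τ, HasDerivAt (fun x => g c x τ) (g' c s τ) s) :
    ∀ (w : List α) {s : ℝ}, s ∈ S → ∀ σ : ℝ, HasDerivAt (fun x => pF g w x σ) (pD g g' w s σ) s
  | [], s, _, σ => by simpa using hasDerivAt_const s (1 : ℝ)
  | c :: w, s, hs, σ => by
    obtain ⟨δ, hδ, hball⟩ := Metric.isOpen_iff.mp hS s hs
    -- the integrand and its `s`-derivative
    set F : ℝ → ℝ → ℝ := fun x τ => g c x τ * pF g w x τ with hF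
    set F' : ℝ → ℝ → ℝ := fun x τ => g' c x τ * pF g w x τ + g c x τ * pD g g' w x τ with hF'
    have hFc : Continuous (Function.uncurry F) := (hg c).mul (continuous_pF hg w)
    have hF'c : Continuous (Function.uncurry F') :=
      ((hg' c).mul (continuous_pF hg w)).add ((hg c).mul (continuous_pD hg hg' w))
    -- a uniform bound of `F'` on `closedBall s (δ/2) × uIcc 0 σ`
    obtain ⟨C, hC⟩ := ((isCompact_closedBall s (δ / 2)).prod isCompact_uIcc).exists_bound_of_continuousOn
      (f := Function.uncurry F') hF'c.continuousOn
    have key := intervalIntegral.hasDerivAt_integral_of_dominated_loc_of_deriv_le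
      (μ := volume) (a := (0 : ℝ)) (b := σ) (F := F) (F' := F') (x₀ := s) (bound := fun _ => C)
      (s := ball s (δ / 2)) (ball_mem_nhds s (by positivity))
      (Eventually.of_forall fun x => (hFc.uncurry_left x).aestronglyMeasurable)
      ((hFc.uncurry_left s).intervalIntegrable _ _)
      ((hF'c.uncurry_left s).aestronglyMeasurable)
      (ae_of_all _ fun τ hτ x hx => hC (x, τ) ⟨mem_closedBall.mpr (mem_ball.mp hx).le,
        uIoc_subset_uIcc hτ⟩)
      intervalIntegrable_const
      (ae_of_all _ fun τ _ x hx => ?_)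
    · simpa [pF_cons, pD_cons] using key.2
    · have hxS : x ∈ S := hball (ball_subset_ball (by linarith) hx)
      exact (hder c x hxS τ).mul (hasDerivAt_pF hS hder w hxS τ)

end Parametric

section SigmaDeriv

variable {α : Type u} {g g' h : α → ℝ → ℝ → ℝ}
  (hg : ∀ c, Continuous fun p : ℝ × ℝ => g c p.1 p.2)
  (hg' : ∀ c, Continuous fun p : ℝ × ℝ => g' c p.1 p.2)

include hg in

/-- FTC in `σ` for `F`: `∂_σ F_{cw}(s,σ) = g_c(s,σ) F_w(s,σ)`. [folklore] -/
theorem hasDerivAt_pF_sigma (c : α) (w : List α) (s σ : ℝ) :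
    HasDerivAt (fun x => pF g (c :: w) s x) (g c s σ * pF g w s σ) σ := by
  have hcont : ∀ c', ContinuousOn (fun τ => g c' s τ) univ := fun c' =>
    ((hg c').comp (Continuous.prodMk_right s)).continuousOn
  exact hasDerivAt_iterInt_cons isOpen_univ ordConnected_univ hcont (mem_univ 0) c w (mem_univ σ)

include hg hg' in

/-- FTC in `σ` for `D`: `∂_σ D_{cw}(s,σ) = g'_c F_w + g_c D_w`. [folklore] -/
theorem hasDerivAt_pD_sigma (c : α) (w : List α) (s σ : ℝ) :
    HasDerivAt (fun x => pD g g' (c :: w) s x)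
      (g' c s σ * pF g w s σ + g c s σ * pD g g' w s σ) σ := by
  have hcont : Continuous fun τ => g' c s τ * pF g w s τ + g c s τ * pD g g' w s τ :=
    (((hg' c).comp (Continuous.prodMk_right s)).mul
      ((continuous_pF hg w).comp (Continuous.prodMk_right s))).add
      (((hg c).comp (Continuous.prodMk_right s)).mul
        ((continuous_pD hg hg' w).comp (Continuous.prodMk_right s)))
  simpa [pD_cons] using hasDerivAt_integral_of_continuousOn' isOpen_univ ordConnected_univ
    hcont.continuousOn (mem_univ (0 : ℝ)) (mem_univ σ)

/-! ### Series packaging at a fixed parameter `s` -/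

/-- `Ĵ(σ) = Σ_w F_w(s,σ) w`, the transport series of `g(s,·)` from `0` to `σ`. [folklore] -/
def pJ (g : α → ℝ → ℝ → ℝ) (s σ : ℝ) : NCSeries α ℝ := fun w => pF g w s σ

/-- `D̂(σ) = Σ_w D_w(s,σ) w = ∂_s Ĵ(σ)`. [folklore] -/
def pDser (g g' : α → ℝ → ℝ → ℝ) (s σ : ℝ) : NCSeries α ℝ := fun w => pD g g' w s σ

/-- Coefficients of `Ĵ`. [folklore] -/
@[simp] theorem pJ_apply (s σ : ℝ) (w : List α) : pJ g s σ w = pF g w s σ := rfl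

/-- Coefficients of `D̂`. [folklore] -/
@[simp] theorem pDser_apply (s σ : ℝ) (w : List α) : pDser g g' s σ w = pD g g' w s σ := rfl

/-- `Ĵ` is a transport series. [folklore] -/
theorem pJ_eq_transportSeries (s σ : ℝ) : pJ g s σ = transportSeries (fun c => g c s) 0 σ := rfl

/-- `Ĵ(0) = 1`. [folklore] -/
@[simp] theorem pJ_zero (s : ℝ) : pJ g s 0 = 1 := transportSeries_self _ _

/-- `D̂(0) = 0`. [folklore] -/
@[simp] theorem pDser_zero (s : ℝ) : pDser g g' s 0 = 0 := by
  ext w; exact pD_zero w s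

/-- Product rule for the Cauchy product, coefficientwise. [folklore] -/
theorem hasDerivAt_mul_apply {P Q : ℝ → NCSeries α ℝ} {P' Q' : NCSeries α ℝ} {x : ℝ}
    (hP : ∀ w, HasDerivAt (fun y => P y w) (P' w) x) (hQ : ∀ w, HasDerivAt (fun y => Q y w) (Q' w) x)
    (w : List α) : HasDerivAt (fun y => (P y * Q y) w) ((P' * Q x + P x * Q') w) x := by
  simp only [NCSeries.mul_apply, NCSeries.add_apply, ← Finset.sum_add_distrib]
  exact HasDerivAt.fun_sum fun p _ => (hP p.1).mul (hQ p.2)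

include hg in

/-- `∂_σ Ĵ = ĝ Ĵ` coefficientwise. [folklore] -/
theorem hasDerivAt_pJ (s σ : ℝ) (w : List α) :
    HasDerivAt (fun x => pJ g s x w) ((NCSeries.letterSeries (fun c => g c s σ) * pJ g s σ) w) σ := by
  cases w with
  | nil => simpa using hasDerivAt_const σ (1 : ℝ)
  | cons c w =>
    rw [NCSeries.letterSeries_mul_apply_cons]
    exact hasDerivAt_pF_sigma hg c w s σ

include hg hg' in

/-- `∂_σ D̂ = ĝ' Ĵ + ĝ D̂` coefficientwise. [folklore] -/
theorem hasDerivAt_pDser (s σ : ℝ) (w : List α) :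
    HasDerivAt (fun x => pDser g g' s x w)
      ((NCSeries.letterSeries (fun c => g' c s σ) * pJ g s σ +
        NCSeries.letterSeries (fun c => g c s σ) * pDser g g' s σ) w) σ := by
  cases w with
  | nil => simpa using hasDerivAt_const σ (0 : ℝ)
  | cons c w =>
    rw [NCSeries.add_apply, NCSeries.letterSeries_mul_apply_cons, NCSeries.letterSeries_mul_apply_cons]
    exact hasDerivAt_pD_sigma hg hg' c w s σ

/-- Derivative of a letter series with differentiable coefficients. [folklore] -/
theorem hasDerivAt_letterSeries {k k' : α → ℝ → ℝ} {x : ℝ}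
    (hk : ∀ c, HasDerivAt (k c) (k' c x) x) (w : List α) :
    HasDerivAt (fun y => NCSeries.letterSeries (fun c => k c y) w) (NCSeries.letterSeries (fun c => k' c x) w) x := by
  match w with
  | [] => simpa using hasDerivAt_const x (0 : ℝ)
  | [c] => simpa using hk c
  | c :: d :: w =>
    simpa [NCSeries.letterSeries_cons_cons] using hasDerivAt_const x (0 : ℝ)

/-- The variation `M̂(σ) := D̂(σ) - b̂(σ) Ĵ(σ) + Ĵ(σ) b̂(0)` for a second letter family `b̂(σ) = Σ_c
h_c(s,σ) c`. [folklore] -/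
def pM (g g' h : α → ℝ → ℝ → ℝ) (s σ : ℝ) : NCSeries α ℝ :=
  pDser g g' s σ - NCSeries.letterSeries (fun c => h c s σ) * pJ g s σ +
    pJ g s σ * NCSeries.letterSeries (fun c => h c s 0)

/-- `M̂(0) = 0`. [folklore] -/
@[simp] theorem pM_zero (s : ℝ) : pM g g' h s 0 = 0 := by
  simp [pM]

include hg hg' in
/-- **The variation identity**: if `∂_σ h_c = ∂_s g_c` then `∂_σ M̂ = ĝ M̂ + [ĝ, b̂] Ĵ`
coefficientwise (Chen 1977, §2). [folklore] -/
theorem hasDerivAt_pM {s : ℝ} (hh : ∀ c σ, HasDerivAt (fun x => h c s x) (g' c s σ) σ) (σ : ℝ)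
    (w : List α) :
    HasDerivAt (fun x => pM g g' h s x w)
      ((NCSeries.letterSeries (fun c => g c s σ) * pM g g' h s σ +
        (NCSeries.letterSeries (fun c => g c s σ) * NCSeries.letterSeries (fun c => h c s σ) -
          NCSeries.letterSeries (fun c => h c s σ) * NCSeries.letterSeries (fun c => g c s σ)) *
            pJ g s σ) w) σ := by
  set G := NCSeries.letterSeries (fun c => g c s σ) with hG
  set G' := NCSeries.letterSeries (fun c => g' c s σ) with hG'
  set B := NCSeries.letterSeries (fun c => h c s σ) with hB
  set B0 := NCSeries.letterSeries (fun c => h c s 0) with hB0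
  have h1 := hasDerivAt_pDser hg hg' s σ
  have h2 : ∀ w, HasDerivAt (fun x => (NCSeries.letterSeries (fun c => h c s x) * pJ g s x) w)
      ((G' * pJ g s σ + B * (G * pJ g s σ)) w) σ :=
    hasDerivAt_mul_apply (hasDerivAt_letterSeries (fun c => hh c σ)) (hasDerivAt_pJ hg s σ)
  have h3 : ∀ w, HasDerivAt (fun x => (pJ g s x * B0) w) ((G * pJ g s σ * B0 + pJ g s σ * 0) w) σ :=
    hasDerivAt_mul_apply (hasDerivAt_pJ hg s σ) (fun w => by simpa using hasDerivAt_const σ (B0 w))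
  have h4 : HasDerivAt (fun x => pM g g' h s x w)
      ((G' * pJ g s σ + G * pDser g g' s σ) w - (G' * pJ g s σ + B * (G * pJ g s σ)) w +
        (G * pJ g s σ * B0 + pJ g s σ * 0) w) σ :=
    ((h1 w).sub (h2 w)).add (h3 w)
  have key : G * pM g g' h s σ + (G * B - B * G) * pJ g s σ =
      (G' * pJ g s σ + G * pDser g g' s σ) - (G' * pJ g s σ + B * (G * pJ g s σ)) +
        (G * pJ g s σ * B0 + pJ g s σ * 0) := by
    simp only [pM, ← hB, ← hB0, mul_zero, add_zero]
    noncomm_ring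
  refine h4.congr_deriv ?_
  rw [← NCSeries.sub_apply, ← NCSeries.add_apply, ← key]

end SigmaDeriv

/-! ## Linear-algebra lemmas: kernels are closed under integration; nilpotent uniqueness -/

section Kernel

variable {V : Type*} [AddCommGroup V] [Module ℝ V]

/-- **A submodule is closed under (finite-coefficient) integration**: if `Σ_i D_i(s) • m_i ∈ S` for
all `s ∈ [a,b]` then `Σ_i (∫_a^b D_i) • m_i ∈ S` (functionals on `V ⧸ S` separate points; no
topology on `V` needed). [folklore] -/
theorem sum_integral_smul_mem {ι : Type*} (T : Finset ι) (S : Submodule ℝ V) {a b : ℝ}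
    (D : ι → ℝ → ℝ) (m : ι → V) (hD : ∀ i ∈ T, IntervalIntegrable (D i) volume a b)
    (hmem : ∀ s ∈ uIcc a b, ∑ i ∈ T, D i s • m i ∈ S) :
    ∑ i ∈ T, (∫ s in a..b, D i s) • m i ∈ S := by
  rw [← Submodule.Quotient.mk_eq_zero, ← Submodule.mkQ_apply, map_sum]
  simp only [map_smul]
  refine (Module.forall_dual_apply_eq_zero_iff ℝ _).mp fun φ => ?_
  rw [map_sum]
  simp only [map_smul, smul_eq_mul]
  have h1 : ∑ i ∈ T, (∫ s in a..b, D i s) * φ (S.mkQ (m i)) =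
      ∫ s in a..b, ∑ i ∈ T, D i s * φ (S.mkQ (m i)) := by
    rw [intervalIntegral.integral_finsetSum fun i hi => (hD i hi).mul_const _]
    simp only [intervalIntegral.integral_mul_const]
  rw [h1, intervalIntegral.integral_congr (g := fun _ => (0 : ℝ)) fun s hs => ?_]
  · simp
  · have h2 : φ (Submodule.Quotient.mk (∑ i ∈ T, D i s • m i) : V ⧸ S) =
        ∑ i ∈ T, D i s * φ (Submodule.Quotient.mk (m i)) := by
      rw [← Submodule.mkQ_apply, map_sum, map_sum]
      simp only [map_smul, smul_eq_mul, Submodule.mkQ_apply]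
    show ∑ i ∈ T, D i s * φ (Submodule.Quotient.mk (m i)) = 0
    rw [← h2, (Submodule.Quotient.mk_eq_zero S).mpr (hmem s hs), map_zero]

end Kernel

section Uniqueness

variable {α : Type u} [Fintype α] [DecidableEq α] {A : Type*} [Ring A] [Algebra ℝ A]

/-- `evalTrunc` as a finite sum over the words of length `≤ N`, for `ℝ`-coefficients
(`NCSeries.evalTrunc_eq_sum_wordsLE`). [folklore] -/
theorem evalTrunc_eq_sum (N : ℕ) (v : α → A) (φ : NCSeries α ℝ) :
    NCSeries.evalTrunc N v φ = ∑ w ∈ NCSeries.wordsLE α N, φ w • (w.map v).prod :=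
  NCSeries.evalTrunc_eq_sum_wordsLE N v φ

/-- **Submodules are closed under integration of series through `ev`**: if the coefficients of `Ŷ(b)
- Ŷ(a)` are the integrals of those of `N̂` and `ev(N̂ s) ∈ S` on `[a,b]`, then `ev(Ŷ b) - ev(Ŷ a) ∈
S`. [folklore] -/
theorem evalTrunc_sub_mem_of_integral (N : ℕ) (v : α → A) (S : Submodule ℝ A) {a b : ℝ}
    (Y : ℝ → NCSeries α ℝ) (D : ℝ → NCSeries α ℝ)
    (hD : ∀ w, IntervalIntegrable (fun s => D s w) volume a b)
    (hFTC : ∀ w, Y b w - Y a w = ∫ s in a..b, D s w)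
    (hmem : ∀ s ∈ uIcc a b, NCSeries.evalTrunc N v (D s) ∈ S) :
    NCSeries.evalTrunc N v (Y b) - NCSeries.evalTrunc N v (Y a) ∈ S := by
  rw [evalTrunc_eq_sum, evalTrunc_eq_sum, ← Finset.sum_sub_distrib]
  simp only [← sub_smul, hFTC]
  refine sum_integral_smul_mem _ S (fun w s => D s w) _ (fun w _ => hD w) fun s hs => ?_
  rw [← evalTrunc_eq_sum]; exact hmem s hs

/-- **Nilpotent uniqueness**: for submodules `T₀ = ⊤ ⊇ ⋯ ⊇ T_K = ⊥` with `v(c) T_j ⊆ T_{j+1}`, if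
`∂_σ M̂ = N̂` coefficientwise on `[a,b]`, `ev(N̂ σ) = ev(k̂(σ) M̂ σ)` for a letter series `k̂`, and
`ev(M̂ a) = 0`, then `ev(M̂ σ) = 0` on `[a,b]`. [folklore] -/
theorem evalTrunc_eq_zero_of_hasDerivAt (N K : ℕ) (v : α → A)
    (hv : ∀ w : List α, N < w.length → (w.map v).prod = 0)
    (T : ℕ → Submodule ℝ A) (hT0 : T 0 = ⊤) (hTK : T K = ⊥)
    (hTmul : ∀ j c, ∀ x ∈ T j, v c * x ∈ T (j + 1))
    {a b : ℝ} (M D : ℝ → NCSeries α ℝ) (k : α → ℝ → ℝ)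
    (hderiv : ∀ w, ∀ σ ∈ Icc a b, HasDerivAt (fun x => M x w) (D σ w) σ)
    (hcont : ∀ w, ContinuousOn (fun σ => D σ w) (Icc a b))
    (hflat : ∀ σ ∈ Icc a b, NCSeries.evalTrunc N v (D σ) =
      NCSeries.evalTrunc N v (NCSeries.letterSeries (fun c => k c σ) * M σ))
    (h0 : NCSeries.evalTrunc N v (M a) = 0) :
    ∀ σ ∈ Icc a b, NCSeries.evalTrunc N v (M σ) = 0 := by
  have step : ∀ j, ∀ σ ∈ Icc a b, NCSeries.evalTrunc N v (M σ) ∈ T j := by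
    intro j
    induction j with
    | zero => intro σ _; rw [hT0]; trivial
    | succ j ih =>
      intro σ hσ
      have hsub : Icc a σ ⊆ Icc a b := Icc_subset_Icc_right hσ.2
      have hmem : ∀ τ ∈ uIcc a σ, NCSeries.evalTrunc N v (D τ) ∈ T (j + 1) := by
        intro τ hτ
        rw [uIcc_of_le hσ.1] at hτ
        have hτ' : τ ∈ Icc a b := hsub hτ
        rw [hflat τ hτ', NCSeries.evalTrunc_mul N v hv, evalTrunc_eq_sum, Finset.sum_mul]
        refine Submodule.sum_mem _ fun w _ => ?_
        match w with
        | [] => simp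
        | [c] => simpa [smul_mul_assoc] using Submodule.smul_mem _ _ (hTmul j c _ (ih τ hτ'))
        | c :: d :: w => simp [NCSeries.letterSeries_cons_cons]
      have h := evalTrunc_sub_mem_of_integral N v (T (j + 1)) (a := a) (b := σ) M D
        (fun w => ((hcont w).mono hsub).intervalIntegrable_of_Icc hσ.1)
        (fun w => (integral_eq_sub_of_hasDerivAt (fun τ hτ => hderiv w τ (hsub (by
            rwa [uIcc_of_le hσ.1] at hτ)))
          (((hcont w).mono hsub).intervalIntegrable_of_Icc hσ.1)).symm) hmem
      rwa [h0, sub_zero] at h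
  intro σ hσ
  have := step K σ hσ
  rwa [hTK, Submodule.mem_bot] at this

end Uniqueness

end Literature.NumberTheory.Transcendental
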